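import Literature.NumberTheory.EllipticCurves.BinaryQuarticDiscriminantStrata
import Literature.NumberTheory.EllipticCurves.BinaryQuarticMinimisationPrimeProofs
import HarnessLib

/-!
# The number of binary quartic forms over a finite field with prescribed invariants:
# `#{f ∈ V(𝔽_q) : I(f) = I, J(f) = J} = q³ − q` for `4I³ ≠ J²`

`Proofs` companion of `BinaryQuarticForms.lean` (theorems only: no definitions, no named facts).

Source and role. M. Bhargava, A. Shankar, *Binary quartic forms having bounded invariants, and the
boundedness of the average rank of elliptic curves*, Ann. of Math. (2) 181 (2015) 191–242. Two
inputs of the proof of their Theorem 1.1 concern the fibres `V_{I,J} = {f : I(f) = I, J(f) = J}` of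
the invariant map over *finite* and *`p`-adic* rings: the `p`-adic masses of Prop. 5.12 of the held
arXiv text `arXiv:1006.1002v2` (= Props. 3.7–3.9 of the published version: the change of measure
`μ_p(S) = |1/27|_p · Vol(PGL₂(ℤ_p)) · Σ 1/#Stab`, with `Vol(PGL₂(ℤ_p)) = #PGL₂(𝔽_p)/p³ = 1 − p⁻²`), and
the uniformity / local solubility estimate Prop. 5.13 (= Prop. 3.18 of the published version), whose
proof uses that a form with `p ∤ Δ(f)` is `ℚ_p`-soluble. This file proves the finite-field count
underlying both:

* `BinaryQuartic.natCard_invariants_eq`: for a finite field `F` with `q` elements in which `2 ≠ 0` and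
  `3 ≠ 0`, and `(I, J) ∈ F²` with `4I³ − J² ≠ 0`,
  **`#{f ∈ V_F : I(f) = I, J(f) = J} = q³ − q = #PGL₂(F)`**.

The count is uniform in `(I, J)` and needs no point counting on elliptic curves: for `a ≠ 0` the
shear `x ↦ x + ty` is `q`-to-`1` onto the depressed forms `(a, 0, c, d, e)`, for which `e` is forced
(`12ae = I − c²`) and the remaining condition is `27ad² = −8c³ + 6Ic − J`; for each `c` the pairs
`(a, d)` with `a ≠ 0` solving it number `q − 1` (whether or not the right-hand side vanishes), giving
`q · q(q − 1)` forms; for `a = 0` (then `b ≠ 0` as `4I³ ≠ J²`) the shear is transitive on `c`, and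
`d`, `e` are forced, giving `q(q − 1)` forms; and `q²(q − 1) + q(q − 1) = q³ − q`.

The companion `BinaryQuarticFiniteFieldSolubilityProofs.lean` combines this count with the order of
the stabilisers (Lemma 5.11, `BinaryQuartic.pgl2StabilizerCard_eq`) and an explicit `2`-descent to
show that every form with `Δ ≠ 0` over such a field is soluble — the genus-one input of Prop. 5.13 /
Prop. 3.18 without the Hasse–Weil bound.

## References

* M. Bhargava, A. Shankar, Ann. of Math. (2) 181 (2015) 191–242 = arXiv:1006.1002, Props. 5.12–5.13
  of the arXiv v2 text (Props. 3.7, 3.9, 3.18 of the published version).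
  [cite: BhargavaShankarAnnals2015, Props. 5.12–5.13 (arXiv:1006.1002v2 numbering)]
-/

noncomputable section

open scoped Classical

namespace Literature.NumberTheory.EllipticCurves

namespace BinaryQuartic

section Shear

variable {R : Type*} [CommRing R]

/-- Shears compose additively: shearing by `s` and then by `t` is shearing by `s + t`. [folklore] -/
theorem subst_shear_shear (f : BinaryQuartic R) (s t : R) :
    (f.subst !![1, 0; s, 1]).subst !![1, 0; t, 1] = f.subst !![1, 0; s + t, 1] := by
  simp only [subst_lowerShear]
  ext <;> ring

/-- The trivial shear is the identity. [folklore] -/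
theorem subst_shear_zero (f : BinaryQuartic R) : f.subst !![1, 0; (0 : R), 1] = f := by
  rw [subst_lowerShear]; ext <;> simp

/-- Shears have determinant `1`, so they preserve `I`. [folklore] -/
theorem I_subst_shear (f : BinaryQuartic R) (t : R) : (f.subst !![1, 0; t, 1]).I = f.I := by
  rw [I_subst]; simp [Matrix.det_fin_two]

/-- Shears have determinant `1`, so they preserve `J`. [folklore] -/
theorem J_subst_shear (f : BinaryQuartic R) (t : R) : (f.subst !![1, 0; t, 1]).J = f.J := by
  rw [J_subst]; simp [Matrix.det_fin_two]

/-- A form divisible by `y²` (`a = b = 0`) has `4I³ = J²` (`I = c²`, `J = −2c³`). [folklore] -/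
theorem four_I_cube_sub_J_sq_of_a_b {f : BinaryQuartic R} (ha : f.a = 0) (hb : f.b = 0) :
    4 * f.I ^ 3 - f.J ^ 2 = 0 := by
  simp only [I, J, ha, hb]; ring

/-- For a depressed form `(a, 0, c, d, e)`: `I = 12ae + c²`. [folklore] -/
theorem I_of_b_eq_zero {f : BinaryQuartic R} (hb : f.b = 0) : f.I = 12 * f.a * f.e + f.c ^ 2 := by
  simp only [I, hb]; ring

/-- For a depressed form `(a, 0, c, d, e)`: `J = 72ace − 27ad² − 2c³`. [folklore] -/
theorem J_of_b_eq_zero {f : BinaryQuartic R} (hb : f.b = 0) :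
    f.J = 72 * f.a * f.c * f.e - 27 * f.a * f.d ^ 2 - 2 * f.c ^ 3 := by
  simp only [J, hb]; ring

end Shear

section Count

variable {F : Type*} [Field F]

/-- Numeral bookkeeping: `2 ≠ 0`, `3 ≠ 0` give `4, 12, 27 ≠ 0`. [folklore] -/
theorem four_twelve_twentySeven_ne_zero (h2 : (2 : F) ≠ 0) (h3 : (3 : F) ≠ 0) :
    (4 : F) ≠ 0 ∧ (12 : F) ≠ 0 ∧ (27 : F) ≠ 0 := by
  refine ⟨?_, ?_, ?_⟩
  · rw [show (4 : F) = 2 * 2 by norm_num]; exact mul_ne_zero h2 h2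
  · rw [show (12 : F) = 2 * 2 * 3 by norm_num]; exact mul_ne_zero (mul_ne_zero h2 h2) h3
  · rw [show (27 : F) = 3 * 3 * 3 by norm_num]; exact mul_ne_zero (mul_ne_zero h3 h3) h3

/-- **The `a ≠ 0` part, first reduction: the shear `x ↦ x + ty` is `q`-to-`1` onto depressed
forms.** Forms with invariants `(I, J)` and `a ≠ 0` correspond to pairs `(t, g)` with `g` such a
form having `b = 0` (`t = b/(4a)`). [folklore] -/
theorem natCard_invariants_a_ne_zero_eq_mul [Fintype F] (h2 : (2 : F) ≠ 0) (I J : F) :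
    Nat.card {f : BinaryQuartic F // (f.I = I ∧ f.J = J) ∧ f.a ≠ 0} =
      Fintype.card F *
        Nat.card {g : BinaryQuartic F // (g.I = I ∧ g.J = J) ∧ g.a ≠ 0 ∧ g.b = 0} := by
  have h4 : (4 : F) ≠ 0 := by rw [show (4 : F) = 2 * 2 by norm_num]; exact mul_ne_zero h2 h2
  have e : {f : BinaryQuartic F // (f.I = I ∧ f.J = J) ∧ f.a ≠ 0} ≃
      F × {g : BinaryQuartic F // (g.I = I ∧ g.J = J) ∧ g.a ≠ 0 ∧ g.b = 0} :=
    { toFun := fun f ↦ ⟨f.1.b / (4 * f.1.a),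
        ⟨f.1.subst !![1, 0; -(f.1.b / (4 * f.1.a)), 1], by
          obtain ⟨⟨hI, hJ⟩, ha⟩ := f.2
          refine ⟨⟨by rw [I_subst_shear, hI], by rw [J_subst_shear, hJ]⟩, ?_, ?_⟩
          · rw [subst_lowerShear]; exact ha
          · rw [subst_lowerShear]; dsimp only; field_simp; ring⟩⟩
      invFun := fun p ↦ ⟨p.2.1.subst !![1, 0; p.1, 1], by
          obtain ⟨⟨hI, hJ⟩, ha, -⟩ := p.2.2
          refine ⟨⟨by rw [I_subst_shear, hI], by rw [J_subst_shear, hJ]⟩, ?_⟩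
          rw [subst_lowerShear]; exact ha⟩
      left_inv := fun f ↦ by
        apply Subtype.ext
        simp only [subst_shear_shear, neg_add_cancel, subst_shear_zero]
      right_inv := fun p ↦ by
        obtain ⟨t, g, ⟨hI, hJ⟩, ha, hb⟩ := p
        have ht : (g.subst !![1, 0; t, 1]).b / (4 * (g.subst !![1, 0; t, 1]).a) = t := by
          rw [subst_lowerShear]; dsimp only; rw [hb]; field_simp; ring
        refine Prod.ext ht (Subtype.ext ?_)
        simp only [ht, subst_shear_shear, add_neg_cancel, subst_shear_zero] }
  rw [Nat.card_congr e, Nat.card_prod, Nat.card_eq_fintype_card]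

/-- **The `a ≠ 0` part, second reduction: a depressed form with invariants `(I, J)` is
`(a, 0, c, d, (I − c²)/(12a))` with `27ad² = −8c³ + 6Ic − J`.** [folklore] -/
theorem natCard_depressed_eq [Fintype F] (h2 : (2 : F) ≠ 0) (h3 : (3 : F) ≠ 0) (I J : F) :
    Nat.card {g : BinaryQuartic F // (g.I = I ∧ g.J = J) ∧ g.a ≠ 0 ∧ g.b = 0} =
      Nat.card {x : F × F × F //
        x.1 ≠ 0 ∧ 27 * x.1 * x.2.2 ^ 2 = -8 * x.2.1 ^ 3 + 6 * I * x.2.1 - J} := by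
  have h12 : (12 : F) ≠ 0 := (four_twelve_twentySeven_ne_zero h2 h3).2.1
  refine Nat.card_congr
    { toFun := fun g ↦ ⟨(g.1.a, g.1.c, g.1.d), by
        obtain ⟨⟨hI, hJ⟩, ha, hb⟩ := g.2
        refine ⟨ha, ?_⟩
        have hI' := I_of_b_eq_zero hb
        have hJ' := J_of_b_eq_zero hb
        rw [hI] at hI'; rw [hJ] at hJ'
        dsimp only
        linear_combination hJ' - 6 * g.1.c * hI'⟩
      invFun := fun x ↦ ⟨⟨x.1.1, 0, x.1.2.1, x.1.2.2, (I - x.1.2.1 ^ 2) / (12 * x.1.1)⟩, by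
        obtain ⟨ha, hrel⟩ := x.2
        have he : 12 * x.1.1 * ((I - x.1.2.1 ^ 2) / (12 * x.1.1)) = I - x.1.2.1 ^ 2 := by
          field_simp
        refine ⟨⟨?_, ?_⟩, ha, rfl⟩
        · rw [I_of_b_eq_zero rfl]; dsimp only; linear_combination he
        · rw [J_of_b_eq_zero rfl]; dsimp only
          linear_combination 6 * x.1.2.1 * he - hrel⟩
      left_inv := fun g ↦ ?_
      right_inv := fun x ↦ rfl }
  obtain ⟨g, ⟨hI, hJ⟩, ha, hb⟩ := g
  apply Subtype.ext
  have hI' := I_of_b_eq_zero hb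
  rw [hI] at hI'
  ext <;> dsimp only
  · exact hb.symm
  · field_simp; linear_combination hI'

/-- **The `a ≠ 0` part, third reduction: for each `c`, the pairs `(a, d)` with `a ≠ 0` and
`27ad² = r` number `q − 1`** — if `r = 0` they are the `(a, 0)`, if `r ≠ 0` then `d ≠ 0` is free
and `a = r/(27d²)`. [folklore] -/
theorem natCard_pairs_eq [Fintype F] (h3 : (3 : F) ≠ 0) (r : F) :
    Nat.card {y : F × F // y.1 ≠ 0 ∧ 27 * y.1 * y.2 ^ 2 = r} = Fintype.card F - 1 := by
  have h27 : (27 : F) ≠ 0 := by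
    rw [show (27 : F) = 3 * 3 * 3 by norm_num]; exact mul_ne_zero (mul_ne_zero h3 h3) h3
  rw [← Fintype.card_units, ← Nat.card_eq_fintype_card,
    Nat.card_congr (unitsEquivNeZero (G₀ := F))]
  by_cases hr : r = 0
  · -- `(a, 0)` with `a ≠ 0`
    refine Nat.card_congr
      { toFun := fun y ↦ ⟨y.1.1, y.2.1⟩
        invFun := fun a ↦ ⟨(a.1, 0), a.2, by simp [hr]⟩
        left_inv := fun y ↦ ?_
        right_inv := fun a ↦ rfl }
    obtain ⟨⟨a, d⟩, ha, hrel⟩ := y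
    have hd : d = 0 := by
      rw [hr] at hrel
      have : (27 * a) * d ^ 2 = 0 := by linear_combination hrel
      rcases mul_eq_zero.mp this with h | h
      · exact absurd h (mul_ne_zero h27 ha)
      · exact pow_eq_zero_iff two_ne_zero |>.mp h
    exact Subtype.ext (Prod.ext rfl hd.symm)
  · -- `d ≠ 0` free, `a = r/(27 d²)`
    refine Nat.card_congr
      { toFun := fun y ↦ ⟨y.1.2, fun hd ↦ hr ?_⟩
        invFun := fun d ↦ ⟨(r / (27 * d.1 ^ 2), d.1), ?_, ?_⟩
        left_inv := fun y ↦ ?_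
        right_inv := fun d ↦ rfl }
    · have := y.2.2; rw [hd] at this; linear_combination -this
    · exact div_ne_zero hr (mul_ne_zero h27 (pow_ne_zero _ d.2))
    · have hd := d.2; dsimp only; field_simp
    · obtain ⟨⟨a, d⟩, ha, hrel⟩ := y
      apply Subtype.ext
      dsimp only at hrel ⊢
      have hd : d ≠ 0 := by rintro rfl; exact hr (by linear_combination -hrel)
      simp only [Prod.mk.injEq, and_true]
      rw [div_eq_iff (mul_ne_zero h27 (pow_ne_zero 2 hd))]
      linear_combination -hrel

/-- **The `a ≠ 0` part of the count: `q · q · (q − 1)` forms.** [folklore] -/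
theorem natCard_invariants_a_ne_zero [Fintype F] (h2 : (2 : F) ≠ 0) (h3 : (3 : F) ≠ 0) (I J : F) :
    Nat.card {f : BinaryQuartic F // (f.I = I ∧ f.J = J) ∧ f.a ≠ 0} =
      Fintype.card F * (Fintype.card F * (Fintype.card F - 1)) := by
  rw [natCard_invariants_a_ne_zero_eq_mul h2, natCard_depressed_eq h2 h3 I J]
  congr 1
  -- fibre over `c`
  set R : F → F := fun c ↦ -8 * c ^ 3 + 6 * I * c - J with hR
  let proj : {x : F × F × F // x.1 ≠ 0 ∧ 27 * x.1 * x.2.2 ^ 2 = R x.2.1} → F := fun x ↦ x.1.2.1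
  have hfib : ∀ c, Nat.card {x // proj x = c} = Fintype.card F - 1 := fun c ↦ by
    rw [← natCard_pairs_eq h3 (R c)]
    refine Nat.card_congr
      { toFun := fun x ↦ ⟨(x.1.1.1, x.1.1.2.2), x.1.2.1, by
          have h1 := x.1.2.2
          have h2 : x.1.1.2.1 = c := x.2
          rw [h2] at h1
          exact h1⟩
        invFun := fun y ↦ ⟨⟨(y.1.1, c, y.1.2), y.2.1, y.2.2⟩, rfl⟩
        left_inv := fun x ↦ ?_
        right_inv := fun y ↦ rfl }
    obtain ⟨⟨⟨a, c', d⟩, ha, hrel⟩, hc⟩ := x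
    change c' = c at hc
    subst hc
    rfl
  rw [← Nat.card_congr (Equiv.sigmaFiberEquiv proj), Nat.card_sigma,
    Finset.sum_congr rfl (fun c _ ↦ hfib c), Finset.sum_const, Finset.card_univ, smul_eq_mul]

/-- `a = 0` and `4I³ ≠ J²` force `b ≠ 0`. [folklore] -/
theorem b_ne_zero_of_a_eq_zero {f : BinaryQuartic F} {I J : F} (hIJ : 4 * I ^ 3 - J ^ 2 ≠ 0)
    (hI : f.I = I) (hJ : f.J = J) (ha : f.a = 0) : f.b ≠ 0 := fun hb ↦
  hIJ (by rw [← hI, ← hJ]; exact four_I_cube_sub_J_sq_of_a_b ha hb)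

/-- **The `a = 0` part, first reduction: then `b ≠ 0`, and the shear is `q`-to-`1` onto the forms
with `c = 0`** (`t = c/(3b)`). [folklore] -/
theorem natCard_invariants_a_eq_zero_eq_mul [Fintype F] (h3 : (3 : F) ≠ 0) {I J : F}
    (hIJ : 4 * I ^ 3 - J ^ 2 ≠ 0) :
    Nat.card {f : BinaryQuartic F // (f.I = I ∧ f.J = J) ∧ ¬ f.a ≠ 0} =
      Fintype.card F *
        Nat.card {g : BinaryQuartic F // (g.I = I ∧ g.J = J) ∧ g.a = 0 ∧ g.c = 0} := by
  have e : {f : BinaryQuartic F // (f.I = I ∧ f.J = J) ∧ ¬ f.a ≠ 0} ≃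
      F × {g : BinaryQuartic F // (g.I = I ∧ g.J = J) ∧ g.a = 0 ∧ g.c = 0} :=
    { toFun := fun f ↦ ⟨f.1.c / (3 * f.1.b),
        ⟨f.1.subst !![1, 0; -(f.1.c / (3 * f.1.b)), 1], by
          obtain ⟨⟨hI, hJ⟩, ha⟩ := f.2
          rw [not_not] at ha
          have hb : f.1.b ≠ 0 := b_ne_zero_of_a_eq_zero hIJ hI hJ ha
          refine ⟨⟨by rw [I_subst_shear, hI], by rw [J_subst_shear, hJ]⟩, ?_, ?_⟩
          · rw [subst_lowerShear]; exact ha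
          · rw [subst_lowerShear]; dsimp only; rw [ha]
            simp only [mul_zero, zero_mul, zero_add]; field_simp; ring⟩⟩
      invFun := fun p ↦ ⟨p.2.1.subst !![1, 0; p.1, 1], by
          obtain ⟨⟨hI, hJ⟩, ha, -⟩ := p.2.2
          refine ⟨⟨by rw [I_subst_shear, hI], by rw [J_subst_shear, hJ]⟩, ?_⟩
          rw [subst_lowerShear, not_not]; exact ha⟩
      left_inv := fun f ↦ by
        apply Subtype.ext
        simp only [subst_shear_shear, neg_add_cancel, subst_shear_zero]
      right_inv := fun p ↦ by
        obtain ⟨t, g, ⟨hI, hJ⟩, ha, hc⟩ := p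
        have hb : g.b ≠ 0 := b_ne_zero_of_a_eq_zero hIJ hI hJ ha
        have ht : (g.subst !![1, 0; t, 1]).c / (3 * (g.subst !![1, 0; t, 1]).b) = t := by
          rw [subst_lowerShear]; dsimp only; rw [ha, hc]
          simp only [mul_zero, zero_mul, zero_add, add_zero]; field_simp
        refine Prod.ext ht (Subtype.ext ?_)
        simp only [ht, subst_shear_shear, add_neg_cancel, subst_shear_zero] }
  rw [Nat.card_congr e, Nat.card_prod, Nat.card_eq_fintype_card]

/-- **The `a = 0` part, second reduction: a form `(0, b, 0, d, e)` with invariants `(I, J)` is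
`(0, b, 0, −I/(3b), −J/(27b²))`, `b ≠ 0` free**, so there are `q − 1` of them. [folklore] -/
theorem natCard_cubicDepressed_eq [Fintype F] (h3 : (3 : F) ≠ 0) {I J : F}
    (hIJ : 4 * I ^ 3 - J ^ 2 ≠ 0) :
    Nat.card {g : BinaryQuartic F // (g.I = I ∧ g.J = J) ∧ g.a = 0 ∧ g.c = 0} =
      Fintype.card F - 1 := by
  have h27 : (27 : F) ≠ 0 := by
    rw [show (27 : F) = 3 * 3 * 3 by norm_num]; exact mul_ne_zero (mul_ne_zero h3 h3) h3
  rw [← Fintype.card_units, ← Nat.card_eq_fintype_card,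
    Nat.card_congr (unitsEquivNeZero (G₀ := F))]
  refine Nat.card_congr
    { toFun := fun g ↦ ⟨g.1.b, b_ne_zero_of_a_eq_zero hIJ g.2.1.1 g.2.1.2 g.2.2.1⟩
      invFun := fun b ↦ ⟨⟨0, b.1, 0, -I / (3 * b.1), -J / (27 * b.1 ^ 2)⟩, by
        have hb := b.2
        refine ⟨⟨?_, ?_⟩, rfl, rfl⟩
        · simp only [BinaryQuartic.I]; field_simp; ring
        · simp only [BinaryQuartic.J]; field_simp; ring⟩
      left_inv := fun g ↦ ?_
      right_inv := fun b ↦ rfl }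
  obtain ⟨g, ⟨hI, hJ⟩, ha, hc⟩ := g
  have hb : g.b ≠ 0 := b_ne_zero_of_a_eq_zero hIJ hI hJ ha
  have hI' : I = -3 * g.b * g.d := by rw [← hI]; simp only [BinaryQuartic.I, ha, hc]; ring
  have hJ' : J = -27 * g.e * g.b ^ 2 := by rw [← hJ]; simp only [BinaryQuartic.J, ha, hc]; ring
  apply Subtype.ext
  ext <;> dsimp only
  · exact ha.symm
  · exact hc.symm
  · rw [hI']; field_simp
  · rw [hJ']; field_simp

/-- **The `a = 0` part of the count: `q · (q − 1)` forms.** [folklore] -/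
theorem natCard_invariants_a_eq_zero [Fintype F] (h3 : (3 : F) ≠ 0) {I J : F}
    (hIJ : 4 * I ^ 3 - J ^ 2 ≠ 0) :
    Nat.card {f : BinaryQuartic F // (f.I = I ∧ f.J = J) ∧ ¬ f.a ≠ 0} =
      Fintype.card F * (Fintype.card F - 1) := by
  rw [natCard_invariants_a_eq_zero_eq_mul h3 hIJ, natCard_cubicDepressed_eq h3 hIJ]

/-- **The number of binary quartic forms over a finite field with given invariants.** For a finite
field `F` with `q` elements, `2 ≠ 0`, `3 ≠ 0` in `F`, and `4I³ − J² ≠ 0`: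
`#{f ∈ V_F : I(f) = I, J(f) = J} = q³ − q` (`= #PGL₂(F)`; the fibres of the invariant map are
the `PGL₂`-homogeneous spaces behind the `p`-adic masses of Bhargava–Shankar's Prop. 5.12 and the
local solubility input of Prop. 5.13). [cite: BhargavaShankarAnnals2015, Props. 5.12–5.13 (arXiv:1006.1002v2 numbering)] -/
theorem natCard_invariants_eq [Fintype F] (h2 : (2 : F) ≠ 0) (h3 : (3 : F) ≠ 0) {I J : F}
    (hIJ : 4 * I ^ 3 - J ^ 2 ≠ 0) :
    Nat.card {f : BinaryQuartic F // f.I = I ∧ f.J = J} =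
      Fintype.card F ^ 3 - Fintype.card F := by
  have hsplit : Nat.card {f : BinaryQuartic F // f.I = I ∧ f.J = J} =
      Nat.card {f : BinaryQuartic F // (f.I = I ∧ f.J = J) ∧ f.a ≠ 0} +
        Nat.card {f : BinaryQuartic F // (f.I = I ∧ f.J = J) ∧ ¬ f.a ≠ 0} := by
    rw [← Nat.card_congr (Equiv.subtypeSubtypeEquivSubtypeInter (fun f : BinaryQuartic F ↦
        f.I = I ∧ f.J = J) (fun f ↦ f.a ≠ 0)),
      ← Nat.card_congr (Equiv.subtypeSubtypeEquivSubtypeInter (fun f : BinaryQuartic F ↦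
        f.I = I ∧ f.J = J) (fun f ↦ ¬ f.a ≠ 0)), ← Nat.card_sum,
      Nat.card_congr (Equiv.sumCompl (fun f : {f : BinaryQuartic F // f.I = I ∧ f.J = J} ↦
        f.1.a ≠ 0))]
  rw [hsplit, natCard_invariants_a_ne_zero h2 h3, natCard_invariants_a_eq_zero h3 hIJ]
  obtain ⟨n, hn⟩ : ∃ n, Fintype.card F = n + 1 := ⟨Fintype.card F - 1, by
    have := Fintype.card_pos (α := F); omega⟩
  rw [hn, Nat.add_sub_cancel]
  have : (n + 1) ^ 3 = ((n + 1) * ((n + 1) * n) + (n + 1) * n) + (n + 1) := by ring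
  rw [this, Nat.add_sub_cancel]

/-- The same count through the discriminant of a form: for `f₀` with `Δ(f₀) ≠ 0`, the forms with
the invariants of `f₀` number `q³ − q`. [cite: BhargavaShankarAnnals2015, Props. 5.12–5.13 (arXiv:1006.1002v2 numbering)] -/
theorem natCard_invariants_eq_of_disc_ne_zero [Fintype F] (h2 : (2 : F) ≠ 0) (h3 : (3 : F) ≠ 0)
    {f₀ : BinaryQuartic F} (hΔ : f₀.disc ≠ 0) :
    Nat.card {f : BinaryQuartic F // f.I = f₀.I ∧ f.J = f₀.J} =
      Fintype.card F ^ 3 - Fintype.card F := by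
  refine natCard_invariants_eq h2 h3 fun h ↦ hΔ ?_
  have h27 : (27 : F) ≠ 0 := (four_twelve_twentySeven_ne_zero h2 h3).2.2
  have := twentySeven_mul_disc f₀
  rw [h] at this
  exact (mul_eq_zero.mp this).resolve_left h27

end Count

end BinaryQuartic

end Literature.NumberTheory.EllipticCurves

end
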